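import Summits.QuantumFields.BalabanUV.T4Continuum.Support.NE7EJTorusFourier
import Summits.QuantumFields.BalabanUV.T4Continuum.Support.NE7EJSecularCriterion

/-!
# NE7EJTorusAlias — row NE7 (node U5), candidate route HOM, variant H1L-EJ, item EJ-1b′ (T1)–(T3′): the ALIAS FIBRES of the L = 2 blocking on
# `(ℤ∕2N)²` docked to files 117–118, and LENS 1's «4A†A ≤ g(−Δ_plaq)» PROVED ON EVERY EVEN TORUS — `Σ_P ‖Σ_{u,v}F(ιP+u+v)‖² ≤ 64·Re⟨F, g(K)F⟩`
# for every complex plaquette field (`g(K) = 1 − ½K + ⅛K²`, `K = −Δ_plaq`)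

Lineage `b2b-balaban-t4-ne7-p2` (CRUX PROVER NE7 #2 = C-HOM°'s kernel hand), generation 81; file 124 (sequel of 123 `NE7EJTorusFourier`, 118
`NE7EJSecularCriterion`).

SOURCE (lens 1 = `t4-ne7-idea-1` gen 67 NOTE §1 (A2)–(A3) 9e7cf2b6f8adbc99, gen 68 FIBRE-NOTE §1 THEOREM (hh) c9daf19675253d99): «EF^flat ≥ φ(Hess^flat) on
phys ⇔ 4A†A ≤ g(−Δ_plaq) … in each alias block 4A†A = |t⟩⟨t| is RANK ONE with |t_n|² = Π_μ w_μ(n_μ), w_μ(0) = cos⁴(p_μ∕2), w_μ(1) = sin⁴(p_μ∕2) …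
|t⟩⟨t| ≤ diag g(ω_n) ⇔ S_φ(p) ≤ 1 … all M at once».  THIS FILE carries out that reduction in kernel for every even torus:
* §1 the alias fibre over `c ∈ (ℤ∕N)²`: `fibPt c n = base c + N·n`, `n ∈ {0,1}²` — `red2_fibPt`, `fibPt_lab ∕ lab_fibPt` (a bijection), **`sum_fibre_eq`**
  (`Σ_{p ≡ c} f(p) = Σ_n f(p_n(c))`); the angles **`ang_fibPt`** (`θ(p_n(c)_μ) = θ_μ(c) + π·n_μ`, no wrap-around).
* §2 the dictionary to 117–118 on a fibre: `sum_chi_offB`, **`norm_sq_tau16_fibPt`**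
  (`‖τ₁₆(p_n(c))‖² = 256·tSq(θ(c), n)`), **`omegaC_fibPt`** (`ω(p_n(c)) = omegaA(θ(c), n)`), `gSym`, `gK_multiplier_eq`; **`fibre_ineq`** = file 118's
  `flat_block_ineq_complex` on the fibre (`‖Σ_n F̂(p_n)τ₁₆(p_n)‖² ≤ 256·Σ_n g(ω(p_n))‖F̂(p_n)‖²`), **`fibre_sum_ineq`** (summed over all fibres).
* §3 **`master_complex`**: `Σ_P ‖avgS F P‖² ≤ 64·Re Σ_x conj(F x)(g(K)F)(x)` for every `F : (ℤ∕2N)² → ℂ` — lens 1's «4A†A ≤ g(−Δ_plaq)» (with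
  `avgS = 16·A`), on ALL plaquette fields (the mean-zero restriction is not needed: at `p = 0` the block inequality is an equality).
* §4 the real forms `lapR ∕ gKR ∕ avgR` (casts to §3's complex objects) and **`master_real`**: `Σ_P avgR(F)(P)² ≤ 64·Σ_x F(x)(g(K)F)(x)` for every REAL
  plaquette field.
The 1-form statement «EF^flat ≥ ⅛Hess²(4 − Hess)» (docking to file 122's `EFflat`) and (48) on the torus are file 125 `NE7EJFlatBloch`.

HONEST FRAMING: [folklore] (finite Fourier analysis + 117's polynomial certificate + 118's Cauchy–Schwarz criterion); a d = 2, L = 2 FLAT ABELIAN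
TOY RUNG of lens 1's («never the NE7 estimate») — nothing curved ((MI₂) at ε > 0 untouched), nothing d = 4, nothing of Bałaban's instantiated; NOT a
letter move (PRICING-NE7 v50: EJ-1b′ M tag (I), H1L ∕ H1L-EJ XL−); T-50-10 honoured.  NE7 NOT PRINTED ∕ NOT PROVED; spine 0∕9; FIXED FINITE T⁴,
rung (B)+1; NOT infinite volume, NOT mass gap, NOT Clay.  HONEST DEPENDENCY: continuum YM on T⁴ ⇐ BetaPertH ∧ nine spine estimates (0/9 proved);
BetaPertH ⇐ (D1) ∧ (D4) ∧ CAP+tail; G-an2-4 gates asym, D1 and NE2/3/4.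
-/

noncomputable section

open Finset Complex ZMod

namespace Summit.QuantumFields.BalabanUV.T4Continuum.NE7EJTorusAlias

open NE7EJTorusFourier NE7EJFlatSecular NE7EJSecularCriterion

section Fibres

variable (N : ℕ) [NeZero N]

/-! ### Alias fibres: `{p : red p = c} = {base c + N·n : n ∈ {0,1}²}` -/

/-- the val-preserving lift `ℤ∕N → ℤ∕2N`. [folklore] -/
def liftZ (j : ZMod N) : ZMod (2 * N) := ((j.val : ℕ) : ZMod (2 * N))

/-- the base point of the fibre over `c`. [folklore] -/
def base (c : XX N) : XX (2 * N) := (liftZ N c.1, liftZ N c.2)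

/-- the alias shift `N·n`, `n ∈ {0,1}²`. [folklore] -/
def shiftN (n : Bool × Bool) : XX (2 * N) := (((if n.1 then N else 0 : ℕ) : ZMod (2 * N)), ((if n.2 then N else 0 : ℕ) : ZMod (2 * N)))

/-- the fibre point `p_n(c) = base c + N·n`. [folklore] -/
def fibPt (c : XX N) (n : Bool × Bool) : XX (2 * N) := base N c + shiftN N n

/-- `val` of a fibre point coordinate: `c.val + N·[n]` (no wrap-around). [folklore] -/
theorem val_liftZ_add (j : ZMod N) (b : Bool) :
    (liftZ N j + ((if b then N else 0 : ℕ) : ZMod (2 * N))).val = j.val + (if b then N else 0) := by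
  unfold liftZ
  rw [← Nat.cast_add, ZMod.val_natCast, Nat.mod_eq_of_lt]
  have := j.val_lt
  split_ifs <;> omega

/-- coordinates of a fibre point. [folklore] -/
theorem val_fibPt (c : XX N) (n : Bool × Bool) :
    (fibPt N c n).1.val = c.1.val + (if n.1 then N else 0) ∧ (fibPt N c n).2.val = c.2.val + (if n.2 then N else 0) := by
  unfold fibPt base shiftN
  exact ⟨val_liftZ_add N c.1 n.1, val_liftZ_add N c.2 n.2⟩

/-- `red (liftZ j + N·b) = j`. [folklore] -/
theorem red_liftZ_add (j : ZMod N) (b : Bool) : red N (liftZ N j + ((if b then N else 0 : ℕ) : ZMod (2 * N))) = j := by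
  unfold liftZ red
  rw [map_add, map_natCast, map_natCast, ZMod.natCast_zmod_val]
  split_ifs <;> simp

/-- fibre points lie in the fibre: `red2 (p_n(c)) = c`. [folklore] -/
theorem red2_fibPt (c : XX N) (n : Bool × Bool) : red2 N (fibPt N c n) = c := by
  unfold red2 fibPt base shiftN
  simp only [Prod.fst_add, Prod.snd_add, red_liftZ_add]

/-- the label of a fine momentum: `n(p) = (N ≤ p₁.val, N ≤ p₂.val)`. [folklore] -/
def lab (p : XX (2 * N)) : Bool × Bool := (decide (N ≤ p.1.val), decide (N ≤ p.2.val))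

/-- one coordinate of the reconstruction `p = base(red p) + N·n(p)`. [folklore] -/
theorem coord_eq_fib (k : ZMod (2 * N)) : k = liftZ N (red N k) + ((if decide (N ≤ k.val) then N else 0 : ℕ) : ZMod (2 * N)) := by
  apply ZMod.val_injective
  rw [val_liftZ_add]
  unfold red
  rw [ZMod.castHom_apply, ZMod.cast_eq_val, ZMod.val_natCast]
  have hlt := k.val_lt
  have hN : 0 < N := Nat.pos_of_ne_zero (NeZero.ne N)
  by_cases h : N ≤ k.val
  · rw [decide_eq_true h, if_pos rfl]
    have : k.val % N = k.val - N := by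
      rw [Nat.mod_eq_sub_mod h, Nat.mod_eq_of_lt (by omega)]
    omega
  · rw [decide_eq_false h]
    simp only [Bool.false_eq_true, ↓reduceIte, add_zero]
    rw [Nat.mod_eq_of_lt (by omega)]

/-- reconstruction: `p = p_{n(p)}(red2 p)`. [folklore] -/
theorem fibPt_lab (p : XX (2 * N)) : fibPt N (red2 N p) (lab N p) = p := by
  unfold fibPt base shiftN lab red2
  ext <;> simp only [Prod.fst_add, Prod.snd_add] <;> exact (coord_eq_fib N _).symm

/-- and `n(p_n(c)) = n`. [folklore] -/
theorem lab_fibPt (c : XX N) (n : Bool × Bool) : lab N (fibPt N c n) = n := by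
  obtain ⟨h1, h2⟩ := val_fibPt N c n
  have a1 := c.1.val_lt; have a2 := c.2.val_lt
  have hN : 0 < N := Nat.pos_of_ne_zero (NeZero.ne N)
  unfold lab
  rw [h1, h2]
  obtain ⟨n₁, n₂⟩ := n
  cases n₁ <;> cases n₂ <;> simp <;> omega

/-- **fibre sums are sums over the four alias labels**: `Σ_{p : red2 p = c} f(p) = Σ_{n ∈ {0,1}²} f(p_n(c))`. [folklore] -/
theorem sum_fibre_eq (c : XX N) (f : XX (2 * N) → ℂ) : ∑ p ∈ univ.filter (fun p => red2 N p = c), f p = ∑ n : Bool × Bool, f (fibPt N c n) := by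
  refine (sum_bij' (fun n _ => fibPt N c n) (fun p _ => lab N p) ?_ ?_ ?_ ?_ ?_).symm
  · intro n _; exact mem_filter.mpr ⟨mem_univ _, red2_fibPt N c n⟩
  · intro p _; exact mem_univ _
  · intro n _; exact lab_fibPt N c n
  · intro p hp; rw [← (mem_filter.mp hp).2]; exact fibPt_lab N p
  · intro n _; rfl

/-- the same for real-valued summands. [folklore] -/
theorem sum_fibre_eq_real (c : XX N) (f : XX (2 * N) → ℝ) : ∑ p ∈ univ.filter (fun p => red2 N p = c), f p = ∑ n : Bool × Bool, f (fibPt N c n) := by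
  have h := sum_fibre_eq N c (fun p => (f p : ℂ))
  exact_mod_cast h

/-! ### The angles of a fibre point: `θ(p_n(c)_μ) = θ_μ(c) + π·n_μ` -/

/-- the base angle `θ_μ(c) = 2π·c_μ.val∕(2N)`. [folklore] -/
def angB (j : ZMod N) : ℝ := 2 * Real.pi * (j.val : ℝ) / (2 * N : ℕ)

/-- `θ((p_n(c))₁) = θ₁(c) + π·[n₁]` and likewise for the second coordinate. [folklore] -/
theorem ang_fibPt (c : XX N) (n : Bool × Bool) :
    ang (fibPt N c n).1 = angB N c.1 + (if n.1 then Real.pi else 0) ∧ ang (fibPt N c n).2 = angB N c.2 + (if n.2 then Real.pi else 0) := by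
  obtain ⟨h1, h2⟩ := val_fibPt N c n
  have hN : (0 : ℝ) < N := by exact_mod_cast Nat.pos_of_ne_zero (NeZero.ne N)
  have hD : ((2 * N : ℕ) : ℝ) ≠ 0 := by
    have : (2 * N : ℕ) ≠ 0 := by have := NeZero.ne N; omega
    exact_mod_cast this
  unfold ang angB
  rw [h1, h2]
  constructor
  · split_ifs
    · rw [div_eq_iff hD, add_mul, div_mul_cancel₀ _ hD]; push_cast; ring
    · simp
  · split_ifs
    · rw [div_eq_iff hD, add_mul, div_mul_cancel₀ _ hD]; push_cast; ring
    · simp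

end Fibres



/-! ### The alias amplitudes and symbols on a fibre, against files 117–118 -/

section FibreDict

variable (N : ℕ) [NeZero N]

/-- `Σ_{u ∈ {0,1}²} χ_p(u) = (1 + χ_p(e₀))(1 + χ_p(e₁))`. [folklore] -/
theorem sum_chi_offB (p : XX (2 * N)) : ∑ u : Bool × Bool, chi p (offB N u) = (1 + chi p e0) * (1 + chi p e1) := by
  rw [Fintype.sum_prod_type]
  simp only [Fintype.sum_bool, offB, chi, e0, e1]
  simp only [Bool.false_eq_true, ↓reduceIte, mul_one, mul_zero, AddChar.map_zero_eq_one]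
  ring

/-- `cos²((θ + π[b])∕2) = sin²(θ∕2)` if `b`, `cos²(θ∕2)` otherwise. [folklore] -/
theorem cos_sq_half_shift (θ : ℝ) (b : Bool) :
    Real.cos ((θ + if b then Real.pi else 0) / 2) ^ 2 = if b then Real.sin (θ / 2) ^ 2 else Real.cos (θ / 2) ^ 2 := by
  cases b
  · simp
  · simp only [if_true]
    rw [show (θ + Real.pi) / 2 = θ / 2 + Real.pi / 2 by ring, Real.cos_add_pi_div_two]; ring

/-- **the alias amplitude on a fibre**: `‖τ₁₆(p_n(c))‖² = 256·tSq(θ₁(c), θ₂(c), n)` (file 118's `|t_n|²`, scaled by 16²). [folklore] -/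
theorem norm_sq_tau16_fibPt (c : XX N) (n : Bool × Bool) :
    ‖tau16 N (fibPt N c n)‖ ^ 2 = 256 * tSq (angB N c.1) (angB N c.2) n := by
  obtain ⟨a1, a2⟩ := ang_fibPt N c n
  -- `‖1 + e^{iθ}‖² = 4cos²(θ∕2)` (in the tree in several guises, e.g. `normSq (exp(tI) + 1) = 2 + 2cos t`; kept local here)
  have normSq_one_add_exp : ∀ θ : ℝ, ‖(1 : ℂ) + Complex.exp (θ * Complex.I)‖ ^ 2 = 4 * Real.cos (θ / 2) ^ 2 := by
    intro θ
    rw [Complex.sq_norm, Complex.normSq_apply, Complex.add_re, Complex.add_im, Complex.one_re, Complex.one_im,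
      Complex.exp_ofReal_mul_I_re, Complex.exp_ofReal_mul_I_im]
    have h1 := Real.sin_sq_add_cos_sq θ
    have h2 : Real.cos (θ / 2) ^ 2 = 1 / 2 + Real.cos θ / 2 := by
      rw [Real.cos_sq (θ / 2), show 2 * (θ / 2) = θ by ring]
    nlinarith [h1, h2]
  have hS : ‖∑ u : Bool × Bool, chi (fibPt N c n) (offB N u)‖ ^ 2
      = 16 * ((if n.1 then Real.sin (angB N c.1 / 2) ^ 2 else Real.cos (angB N c.1 / 2) ^ 2)
            * (if n.2 then Real.sin (angB N c.2 / 2) ^ 2 else Real.cos (angB N c.2 / 2) ^ 2)) := by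
    rw [sum_chi_offB, norm_mul, mul_pow, chi_e0, chi_e1, a1, a2, normSq_one_add_exp, normSq_one_add_exp, cos_sq_half_shift,
      cos_sq_half_shift]
    ring
  rw [tau16, norm_pow, ← pow_mul, show 2 * 2 = 2 * 2 from rfl, pow_mul, hS]
  unfold tSq
  obtain ⟨n₁, n₂⟩ := n
  cases n₁ <;> cases n₂ <;> simp <;> ring

/-- **the Laplacian symbol on a fibre**: `ω(p_n(c)) = omegaA(θ₁(c), θ₂(c), n)` (file 118's alias symbol). [folklore] -/
theorem omegaC_fibPt (c : XX N) (n : Bool × Bool) : omegaC (fibPt N c n) = ((omegaA (angB N c.1) (angB N c.2) n : ℝ) : ℂ) := by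
  obtain ⟨a1, a2⟩ := ang_fibPt N c n
  rw [omegaC_eq, a1, a2]
  rfl

/-- the real symbol weight `g(ω(p)) = 1 − ½ω(p) + ⅛ω(p)²`. [folklore] -/
def gSym (p : XX (2 * N)) : ℝ := gFlat (4 * Real.sin (ang p.1 / 2) ^ 2 + 4 * Real.sin (ang p.2 / 2) ^ 2)

/-- on a fibre: `gSym(p_n(c)) = gFlat(omegaA(θ(c), n))`. [folklore] -/
theorem gSym_fibPt (c : XX N) (n : Bool × Bool) : gSym N (fibPt N c n) = gFlat (omegaA (angB N c.1) (angB N c.2) n) := by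
  obtain ⟨a1, a2⟩ := ang_fibPt N c n
  unfold gSym; rw [a1, a2]; rfl

/-- the complex multiplier of `g(K)` is the real weight: `1 − ½ω + ⅛ω² = gSym`. [folklore] -/
theorem gK_multiplier_eq (p : XX (2 * N)) : (1 - (1 / 2 : ℂ) * omegaC p + (1 / 8 : ℂ) * omegaC p ^ 2) = ((gSym N p : ℝ) : ℂ) := by
  rw [omegaC_eq]; unfold gSym gFlat; push_cast; ring

/-- **THE PER-FIBRE INEQUALITY** (file 118's `flat_block_ineq_complex` on the alias class of `c`):
`‖Σ_n F̂(p_n)τ₁₆(p_n)‖² ≤ 256·Σ_n g(ω(p_n))‖F̂(p_n)‖²`. [folklore] -/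
theorem fibre_ineq (F : XX (2 * N) → ℂ) (c : XX N) :
    ‖∑ n : Bool × Bool, fhat F (fibPt N c n) * tau16 N (fibPt N c n)‖ ^ 2
      ≤ 256 * ∑ n : Bool × Bool, gFlat (omegaA (angB N c.1) (angB N c.2) n) * ‖fhat F (fibPt N c n)‖ ^ 2 := by
  have ht : ∀ n : Bool × Bool, ‖starRingEnd ℂ (tau16 N (fibPt N c n)) / 16‖ ^ 2 = tSq (angB N c.1) (angB N c.2) n := by
    intro n; rw [norm_div, Complex.norm_conj, div_pow, norm_sq_tau16_fibPt]; norm_num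
  have h := flat_block_ineq_complex (angB N c.1) (angB N c.2) ht (fun n => fhat F (fibPt N c n))
  have e : ∑ n : Bool × Bool, starRingEnd ℂ (starRingEnd ℂ (tau16 N (fibPt N c n)) / 16) * fhat F (fibPt N c n)
      = (∑ n : Bool × Bool, fhat F (fibPt N c n) * tau16 N (fibPt N c n)) / 16 := by
    rw [Finset.sum_div]
    refine sum_congr rfl fun n _ => ?_
    rw [map_div₀, Complex.conj_conj, map_ofNat]; ring
  rw [e, norm_div, div_pow] at h
  have h16 : ‖(16 : ℂ)‖ ^ 2 = 256 := by simp; norm_num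
  rw [h16, div_le_iff₀ (by norm_num : (0:ℝ) < 256)] at h
  linarith

/-- **summed over the fibres**: `Σ_c ‖Σ_{p ∈ fib c} F̂(p)τ₁₆(p)‖² ≤ 256·Σ_p g(ω(p))‖F̂(p)‖²`. [folklore] -/
theorem fibre_sum_ineq (F : XX (2 * N) → ℂ) :
    ∑ c : XX N, ‖∑ p ∈ univ.filter (fun p => red2 N p = c), fhat F p * tau16 N p‖ ^ 2
      ≤ 256 * ∑ p, gSym N p * ‖fhat F p‖ ^ 2 := by
  rw [← sum_fiberwise univ (red2 N) (fun p => gSym N p * ‖fhat F p‖ ^ 2), mul_sum]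
  refine sum_le_sum fun c _ => ?_
  rw [sum_fibre_eq N c, sum_fibre_eq_real N c]
  refine (fibre_ineq N F c).trans (le_of_eq ?_)
  congr 1
  exact sum_congr rfl fun n _ => by rw [gSym_fibPt]

end FibreDict

/-! ### The flat sharp master inequality at the plaquette level, every even torus -/

section Master

variable (N : ℕ) [NeZero N]

/-- **`4AᵀA ≤ g(−Δ_plaq)` ON EVERY EVEN TORUS, complex form**: for every `F : (ℤ∕2N)² → ℂ`,
`Σ_P ‖avgS F P‖² ≤ 64·Re Σ_x conj(F x)·(g(K)F)(x)` (`avgS = 16·A`, so this is `4‖AF‖² ≤ ⟨F, g(K)F⟩`). [folklore] -/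
theorem master_complex (F : XX (2 * N) → ℂ) :
    ∑ P : Fin N × Fin N, ‖avgS N F P‖ ^ 2 ≤ 64 * (∑ x, starRingEnd ℂ (F x) * gK N F x).re := by
  have hN : (0 : ℝ) < N := by exact_mod_cast Nat.pos_of_ne_zero (NeZero.ne N)
  -- (1) M⁴ Σ_P ‖avgS‖² = Σ_P ‖Σ_p F̂τχ‖²
  have h1 : ∀ P, ‖avgS N F P‖ ^ 2 * (2 * (N : ℝ)) ^ 4 = ‖∑ p, (fhat F p * tau16 N p) * chi p (corner N P)‖ ^ 2 := by
    intro P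
    rw [← avgS_fourier, norm_mul, mul_pow, norm_pow, Complex.norm_natCast]; push_cast; ring
  -- (2) coarse Plancherel + fibre inequality
  have h2 := sum_corner_normSq N (fun p => fhat F p * tau16 N p)
  have h3 := fibre_sum_ineq N F
  -- (3) Parseval for g(K): Σ_p gSym ‖F̂‖² = M²·Re⟨F, gK F⟩
  have h4 : ∑ p, gSym N p * ‖fhat F p‖ ^ 2 = (2 * (N : ℝ)) ^ 2 * (∑ x, starRingEnd ℂ (F x) * gK N F x).re := by
    have h := form_gK_fourier N F
    simp_rw [gK_multiplier_eq] at h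
    have hc : ((2 * N : ℕ) : ℂ) ^ 2 = (((2 * (N : ℝ)) ^ 2 : ℝ) : ℂ) := by push_cast; ring
    rw [hc] at h
    simp_rw [← Complex.ofReal_mul] at h
    rw [← Complex.ofReal_sum] at h
    have hre := congrArg Complex.re h
    rw [Complex.re_ofReal_mul, Complex.ofReal_re] at hre
    exact hre.symm
  -- assemble
  have hsum : (∑ P : Fin N × Fin N, ‖avgS N F P‖ ^ 2) * (2 * (N : ℝ)) ^ 4
      ≤ (N : ℝ) ^ 2 * (256 * ((2 * (N : ℝ)) ^ 2 * (∑ x, starRingEnd ℂ (F x) * gK N F x).re)) := by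
    rw [sum_mul]
    simp_rw [h1]
    rw [h2, ← h4]
    exact mul_le_mul_of_nonneg_left h3 (by positivity)
  have hpos : (0 : ℝ) < (2 * (N : ℝ)) ^ 4 := by positivity
  have key : (∑ P : Fin N × Fin N, ‖avgS N F P‖ ^ 2) * (2 * (N : ℝ)) ^ 4
      ≤ (64 * (∑ x, starRingEnd ℂ (F x) * gK N F x).re) * (2 * (N : ℝ)) ^ 4 := by
    calc _ ≤ (N : ℝ) ^ 2 * (256 * ((2 * (N : ℝ)) ^ 2 * (∑ x, starRingEnd ℂ (F x) * gK N F x).re)) := hsum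
      _ = (64 * (∑ x, starRingEnd ℂ (F x) * gK N F x).re) * (2 * (N : ℝ)) ^ 4 := by ring
  exact le_of_mul_le_mul_right key hpos

end Master

/-! ### Real plaquette operators and the real form of the master inequality -/

section RealForms

variable (N : ℕ) [NeZero N]

/-- the real plaquette Laplacian. [folklore] -/
def lapR (F : XX (2 * N) → ℝ) (x : XX (2 * N)) : ℝ := 4 * F x - F (x + e0) - F (x + -e0) - F (x + e1) - F (x + -e1)

/-- the real `g(K)F = F − ½KF + ⅛K(KF)`. [folklore] -/
def gKR (F : XX (2 * N) → ℝ) (x : XX (2 * N)) : ℝ := F x - (1 / 2) * lapR N F x + (1 / 8) * lapR N (lapR N F) x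

/-- the real 16-fold tent sum. [folklore] -/
def avgR (F : XX (2 * N) → ℝ) (P : Fin N × Fin N) : ℝ := ∑ u : Bool × Bool, ∑ v : Bool × Bool, F (corner N P + offB N u + offB N v)

omit [NeZero N] in
/-- casting the real Laplacian. [folklore] -/
theorem lapR_cast (F : XX (2 * N) → ℝ) (x : XX (2 * N)) : ((lapR N F x : ℝ) : ℂ) = lapP (fun y => (F y : ℂ)) x := by
  unfold lapR lapP; push_cast; ring

omit [NeZero N] in
/-- casting `g(K)`. [folklore] -/
theorem gKR_cast (F : XX (2 * N) → ℝ) (x : XX (2 * N)) : ((gKR N F x : ℝ) : ℂ) = gK N (fun y => (F y : ℂ)) x := by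
  unfold gKR gK
  have h1 : (fun y => ((lapR N F y : ℝ) : ℂ)) = lapP (fun y => (F y : ℂ)) := funext fun y => lapR_cast N F y
  push_cast
  rw [lapR_cast, ← h1, lapR_cast, h1]

omit [NeZero N] in
/-- casting the tent sum. [folklore] -/
theorem avgR_cast (F : XX (2 * N) → ℝ) (P : Fin N × Fin N) : ((avgR N F P : ℝ) : ℂ) = avgS N (fun y => (F y : ℂ)) P := by
  unfold avgR avgS; push_cast; rfl

/-- **THE MASTER INEQUALITY, REAL FORM**: `Σ_P (avgR F P)² ≤ 64·Σ_x F(x)·(g(K)F)(x)` for every real plaquette field on `(ℤ∕2N)²`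
(`avgR = 16·AF`: this is lens 1's «4A†A ≤ g(−Δ_plaq)», on ALL plaquette fields). [folklore] -/
theorem master_real (F : XX (2 * N) → ℝ) : ∑ P : Fin N × Fin N, avgR N F P ^ 2 ≤ 64 * ∑ x, F x * gKR N F x := by
  have h := master_complex N (fun y => (F y : ℂ))
  have e1 : ∀ P, ‖avgS N (fun y => (F y : ℂ)) P‖ ^ 2 = avgR N F P ^ 2 := fun P => by
    rw [← avgR_cast, Complex.norm_real, Real.norm_eq_abs, sq_abs]
  have e2 : (∑ x, starRingEnd ℂ ((F x : ℂ)) * gK N (fun y => (F y : ℂ)) x).re = ∑ x, F x * gKR N F x := by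
    simp_rw [← gKR_cast, Complex.conj_ofReal, ← Complex.ofReal_mul]
    rw [← Complex.ofReal_sum, Complex.ofReal_re]
  simp_rw [e1] at h
  rwa [e2] at h

end RealForms

end Summit.QuantumFields.BalabanUV.T4Continuum.NE7EJTorusAlias

end
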